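import Summits.Langlands.Langlands.Theorems.SoloInformedRepairD2St
import Mathlib.Topology.Algebra.OpenSubgroup
import HarnessLib
import HarnessLib.Audit.Tags

/-!
# Repair D2-pst — the potentially semistable Weil–Deligne clause at `v ∣ ℓ` (descent datum) over the constructed `B_st(K_v)`

Summit `Langlands`.  `Theorems/SoloInformedRepairD2StRing` constructed `B_st(F) = B_max(F)[X]` (`φ`, `N`, `Γ_F`)
and `Theorems/SoloInformedRepairD2St` typed Buzzard–Gee 3.2.2 at `v ∣ ℓ` where `rec(π_v)` is TRIVIAL ON
INERTIA.  This file types the remaining case — non-trivial inertial type, `ρ|Γ_{K_v}` potentially semistable —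
WITHOUT spec items WP4 (`L₀ ↪ B_st`) / WP6 (Fontaine's `τ`-isotypic linearisation) of `work/s50/D2_SPEC.md`,
by D2-st's device: pointwise Jordan data, now of the residual Weil-group action.
* §1 (abstract).  `invariantsOn ρ gal U = (E^m ⊗_{ℚ_p} B)^U` for `U ≤ Γ`; for `ρ`, `gal` multiplicative
  (`diagAct_mul`) and `U` normal, the RESIDUAL action `actOn g` of `g ∈ Γ`, trivial on `U`, commuting with
  `φ_D`, `f_D`.
* §2 (constructed ring).  `DstOn ρ_v U = (ℚ̄_p^m ⊗ B_st(F))^U` (Fontaine's `D_{st,L}`, `U = Γ_L`) with `phiDstOn`,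
  `NDstOn`, `N_D φ_D = p φ_D N_D`, `actDstOn` (from `galBstAlgHom_mul`, `map_mul ρ_v`), and the WEIL–DELIGNE
  OPERATOR `rDstOn … f w = act_D(w) ∘ φ_D^{f·(-deg w)}` for `deg w ≤ 0` (Fontaine's `r(w) = w̄ ∘ φ^{-α(w)}`,
  `α(w) = f·deg w`, `f = f(F/ℚ_p)`; `deg` arithmetic, geometric Frobenius `= -1`, tree convention; no inverse of
  `φ_D` is needed since `d_{w⁻¹}(c,k) = d_w(c⁻¹,k)`).  Proved: `N_D r_D(w) = p^{f(-deg w)} r_D(w) N_D`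
  (`NDstOn_comp_rDstOn`; `= q^{-deg w}…`, the tree's `WeilDeligneRep.conj_N` convention), `r_D(w) = 1` for
  `w ∈ U` of degree `0` (`rDstOn_eq_one_of_mem`: smooth on the inertia of `L`), and at `U = ⊤`, `deg w = -1`:
  `r_D(w) = φ_D^f` (`rDstOn_top_of_deg_eq_neg_one`, `mem_DstOn_top_iff`) — D2-st's operator, same normalisation.
* §3 `PstCompatibleAt 𝓡 ι π ρ v hv` (binders of D2-st's `SemistableCompatibleAt` minus "`r` trivial on
  inertia"): ∃ an OPEN NORMAL `U ≤ Γ_{K_v}` and `f_U ≥ 1` with `deg(W_{K_v} ∩ U) = f_U ℤ` (`f_U = f(L/K_v)`,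
  `f_L := f(v|ℓ) f_U = [L₀:ℚ_ℓ]`) such that (i) `D = D_{st,U}(ρ|Γ_{K_v})` is finite of rank `n f_L` over `ℚ̄_ℓ`
  ("`ρ|Γ_{K_v}` becomes semistable over `L`": `D` is free over `L₀ ⊗ ℚ̄_ℓ` of rank `≤ n`, `= n` iff
  `L`-semistable) and (ii) `∀ w, deg w ≤ 0 → d_{(r_D(w),N_D)}(c,k) = f_L · d_{(r(w),N_r)}(c,k)`.
  WHY (ii) IS RIGHT (linear algebra, not formalised): `D = ⊕_τ D_τ` over `τ : L₀ → ℚ̄_ℓ`; `r_D(w)` is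
  `L₀ ⊗ ℚ̄_ℓ`-linear (the semilinearities of `w̄` and `φ^{-α(w)}` cancel), so preserves each `D_τ`;
  `(D_τ, r_D, N_D)` IS Fontaine's `WD(ρ_v)` and `φ_D : D_τ ⥲ D_{τσ⁻¹}` intertwines `(r_D, N_D)` with
  `(r_D, p⁻¹N_D)`, so `d_D = f_L · d_{WD(ρ_v)}`; and `w ↦ d_{(r(w),N)}` DETERMINES the Frobenius-semisimple class
  `⊕ a_{σ,m} σ ⊗ Sp_m`: `Σ_c c·d_w(c,k) = tr(r(w) | ker N^k)` gives the Weil representation `R_k = [ker N^k]^{ss}`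
  and `a_{σ,k} = S_k - S_{k+1} ⊗ |·|`, `S_k = R_k - R_{k-1}` (characters determine semisimple representations in
  characteristic `0`).  So, given (i), (ii) says `WD(ρ|Γ_{K_v})^{F-ss} ≅ r^{F-ss} = ι⁻¹rec(π_v)`: Buzzard–Gee
  3.2.2's `p`-adic Hodge-type clause IN FULL, `τ`-free, basis-free, datum-free.  `∃ U` is sound: for `U = Γ_L`
  with `ρ_v` not `L`-semistable (i) fails in the model; finer `L` are consistent (`D_{st,L'} = L'₀ ⊗ D_{st,L}`).
* §4 `CorrespondsD2Pst := CorrespondsD2St ∧ ∀ v ∣ ℓ, PstCompatibleAt`; (A)/(B)/`GL_n`, `@[conjecture]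
  LanglandsD2Pst` in the summit's quantifier shape verbatim; ladder `LanglandsD2Pst → LanglandsD2St → … →
  LanglandsR3plus` (modulo Deligne–Serre, as before).
Repair menu (`SHARPEST-CORE.md` §3) after this file: R3⁺ ⊂ R3⁺+D2-cris ⊂ D2-st ⊂ D2-pst, all typed over
CONSTRUCTED rings with no pinned datum; D2-pst is the statement-level content of "D2-min" — what remains of
D2-min is proof-side only (`B_st^{Γ_L} = L₀`, `rank ≤ n f_L`, discharging the instance facts).  NOT claimed:
`LanglandsD2Pst ↔ Langlands` (the Statement's `pst` is a pinned datum; PinExclusion stands), bijectivity of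
`φ_D`, any comparison theorem.  Junk values as in D2-st (`deg = 0` off Frobenius powers; `c = 0`, `k = 0`
trivial; `OpenNormalSubgroup` excludes non-open `U`).  A Theorems-side shadow; the Statement is unchanged.
-/

noncomputable section

open scoped MatrixGroups Matrix Classical Polynomial NumberField TensorProduct
open NumberField IsDedekindDomain Field Polynomial Filter
open Literature.NumberTheory.Automorphic Literature.NumberTheory.GaloisRepresentations
open Literature.NumberTheory.PAdicHodge

namespace Summit.Langlands.Langlands.Theorems

namespace D2Pst

open D2Cris D2St

/-! ### §1 Invariants of a subgroup and the residual action -/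

section Abstract

variable {p : ℕ} [Fact p.Prime] {E : Type*} [Field E] [Algebra ℚ_[p] E]
  {Γ : Type*} [Group Γ] {B : Type*} [CommRing B] [Algebra ℚ_[p] B] {m : ℕ}

/-- **`(E^m ⊗_{ℚ_p} B)^U`** for a subgroup `U ≤ Γ`: the invariants of the diagonal action restricted to `U`
(Fontaine's `D_{B,L}(V) = (B ⊗ V)^{G_L}`). [cite: FontaineAsterisque223VIII, Exp. VIII §2.3.7] -/
def invariantsOn (ρ : Γ → GL (Fin m) E) (gal : Γ → (B →ₐ[ℚ_[p]] B)) (U : Subgroup Γ) :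
    Submodule E ((Fin m → E) ⊗[ℚ_[p]] B) :=
  invariants (fun u : U => ρ u) (fun u : U => gal u)

/-- Membership in `(E^m ⊗ B)^U`. [folklore] -/
theorem mem_invariantsOn_iff (ρ : Γ → GL (Fin m) E) (gal : Γ → (B →ₐ[ℚ_[p]] B)) (U : Subgroup Γ)
    (x : (Fin m → E) ⊗[ℚ_[p]] B) :
    x ∈ invariantsOn ρ gal U ↔ ∀ u ∈ U, diagAct ρ gal u x = x :=
  ⟨fun h u hu => h ⟨u, hu⟩, fun h u => h u u.2⟩

/-- The diagonal action is multiplicative when `ρ` and `gal` are. [folklore] -/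
theorem diagAct_mul (ρ : Γ → GL (Fin m) E) (gal : Γ → (B →ₐ[ℚ_[p]] B))
    (hρ : ∀ σ τ, ρ (σ * τ) = ρ σ * ρ τ) (hgal : ∀ σ τ, gal (σ * τ) = (gal σ).comp (gal τ)) (σ τ : Γ) :
    diagAct ρ gal (σ * τ) = diagAct ρ gal σ ∘ₗ diagAct (E := E) ρ gal τ := by
  refine TensorProduct.AlgebraTensorModule.ext fun v b => ?_
  simp only [diagAct, LinearMap.comp_apply, TensorProduct.AlgebraTensorModule.map_tmul,
    AlgHom.toLinearMap_apply, hρ, hgal, Units.val_mul, Matrix.toLin'_mul, AlgHom.comp_apply]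

/-- **The residual action of `g ∈ Γ` on `(E^m ⊗ B)^U`** for `U` normal: `diagAct g` preserves the
`U`-invariants (`u g = g (g⁻¹ u g)`). [cite: FontaineAsterisque223VIII, Exp. VIII §2.3.7] -/
def actOn (ρ : Γ → GL (Fin m) E) (gal : Γ → (B →ₐ[ℚ_[p]] B))
    (hρ : ∀ σ τ, ρ (σ * τ) = ρ σ * ρ τ) (hgal : ∀ σ τ, gal (σ * τ) = (gal σ).comp (gal τ))
    (U : Subgroup Γ) [hU : U.Normal] (g : Γ) : invariantsOn ρ gal U →ₗ[E] invariantsOn ρ gal U :=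
  (diagAct ρ gal g).restrict fun x hx => (mem_invariantsOn_iff ρ gal U _).2 fun u hu => by
    have hmem : g⁻¹ * u * g ∈ U := by simpa using hU.conj_mem u hu g⁻¹
    have key : u * g = g * (g⁻¹ * u * g) := by group
    rw [← LinearMap.comp_apply, ← diagAct_mul ρ gal hρ hgal, key, diagAct_mul ρ gal hρ hgal,
      LinearMap.comp_apply, (mem_invariantsOn_iff ρ gal U x).1 hx _ hmem]

/-- Unfolding lemma for `actOn`. [folklore] -/
@[simp] theorem actOn_apply_coe (ρ : Γ → GL (Fin m) E) (gal : Γ → (B →ₐ[ℚ_[p]] B))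
    (hρ : ∀ σ τ, ρ (σ * τ) = ρ σ * ρ τ) (hgal : ∀ σ τ, gal (σ * τ) = (gal σ).comp (gal τ))
    (U : Subgroup Γ) [U.Normal] (g : Γ) (x : invariantsOn ρ gal U) :
    (actOn ρ gal hρ hgal U g x : (Fin m → E) ⊗[ℚ_[p]] B) = diagAct ρ gal g x := rfl

/-- `U` itself acts trivially on `(E^m ⊗ B)^U`: the residual action factors through `Γ/U`. [folklore] -/
theorem actOn_apply_of_mem (ρ : Γ → GL (Fin m) E) (gal : Γ → (B →ₐ[ℚ_[p]] B))
    (hρ : ∀ σ τ, ρ (σ * τ) = ρ σ * ρ τ) (hgal : ∀ σ τ, gal (σ * τ) = (gal σ).comp (gal τ))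
    (U : Subgroup Γ) [U.Normal] {g : Γ} (hg : g ∈ U) (x : invariantsOn ρ gal U) :
    actOn ρ gal hρ hgal U g x = x :=
  Subtype.ext ((mem_invariantsOn_iff ρ gal U _).1 x.2 g hg)

/-- The residual action commutes with `φ_D` when `φ` commutes with `Γ` on `B`. [folklore] -/
theorem actOn_comp_phiD (ρ : Γ → GL (Fin m) E) (gal : Γ → (B →ₐ[ℚ_[p]] B))
    (hρ : ∀ σ τ, ρ (σ * τ) = ρ σ * ρ τ) (hgal : ∀ σ τ, gal (σ * τ) = (gal σ).comp (gal τ))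
    (U : Subgroup Γ) [U.Normal] (φ : B →ₐ[ℚ_[p]] B) (hφ : ∀ σ, (gal σ).comp φ = φ.comp (gal σ)) (g : Γ) :
    actOn ρ gal hρ hgal U g ∘ₗ phiD (fun u : U => ρ u) (fun u : U => gal u) φ (fun u => hφ u) =
      phiD (fun u : U => ρ u) (fun u : U => gal u) φ (fun u => hφ u) ∘ₗ actOn (E := E) ρ gal hρ hgal U g :=
  LinearMap.ext fun x => Subtype.ext (by
    change diagAct ρ gal g (phiTensor φ (x : (Fin m → E) ⊗[ℚ_[p]] B)) =
      phiTensor φ (diagAct ρ gal g (x : (Fin m → E) ⊗[ℚ_[p]] B))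
    exact LinearMap.congr_fun (diagAct_comp_phiTensor (E := E) ρ gal φ hφ g) x)

/-- The residual action commutes with `f_D` when `f` commutes with `Γ` on `B`. [folklore] -/
theorem actOn_comp_endD (ρ : Γ → GL (Fin m) E) (gal : Γ → (B →ₐ[ℚ_[p]] B))
    (hρ : ∀ σ τ, ρ (σ * τ) = ρ σ * ρ τ) (hgal : ∀ σ τ, gal (σ * τ) = (gal σ).comp (gal τ))
    (U : Subgroup Γ) [U.Normal] (f : B →ₗ[ℚ_[p]] B)
    (hf : ∀ σ, (gal σ).toLinearMap ∘ₗ f = f ∘ₗ (gal σ).toLinearMap) (g : Γ) :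
    actOn ρ gal hρ hgal U g ∘ₗ endD (fun u : U => ρ u) (fun u : U => gal u) f (fun u => hf u) =
      endD (fun u : U => ρ u) (fun u : U => gal u) f (fun u => hf u) ∘ₗ actOn (E := E) ρ gal hρ hgal U g :=
  LinearMap.ext fun x => Subtype.ext (by
    change diagAct ρ gal g (endTensor f (x : (Fin m → E) ⊗[ℚ_[p]] B)) =
      endTensor f (diagAct ρ gal g (x : (Fin m → E) ⊗[ℚ_[p]] B))
    exact LinearMap.congr_fun (diagAct_comp_endTensor (E := E) ρ gal f hf g) x)

end Abstract

/-! ### §2 `D_{st,U}` over the constructed `B_st(F)`, its residual action and the Weil–Deligne operator -/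

section Bst

variable {F : Type} [Field F] [ValuativeRel F] [TopologicalSpace F] [IsNonarchimedeanLocalField F]
  [CharZero F] {p : ℕ} [Fact p.Prime] [Fact (¬ IsUnit (p : integerC F))]
  [IsAdicComplete (Ideal.span {(p : integerC F)}) (integerC F)]

/-- `Γ_F` acts on `B_st(F)` multiplicatively, `ℚ_p`-algebra form. [folklore] -/
theorem galBstAlgHom_mul (σ τ : absoluteGaloisGroup F) :
    galBstAlgHom (F := F) (p := p) (σ * τ) = (galBstAlgHom σ).comp (galBstAlgHom τ) :=
  AlgHom.ext fun x => RingHom.congr_fun (galBst_mul (F := F) (p := p) σ τ) x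

/-- **`D_{st,U}(ρ_v) := (ℚ̄_p^m ⊗_{ℚ_p} B_st(F))^U`** for a framed `ρ_v : Γ_F → GL_m(ℚ̄_p)` and a subgroup
`U ≤ Γ_F` (Fontaine's `D_{st,L}`, `U = Γ_L`), over the CONSTRUCTED `B_st(F) = B_max(F)[X]`.
[cite: FontaineAsterisque223VIII, Exp. VIII §2.3.7] -/
def DstOn {m : ℕ} (ρv : FramedRep (absoluteGaloisGroup F) (PadicAlgCl p) m)
    (U : Subgroup (absoluteGaloisGroup F)) :
    Submodule (PadicAlgCl p) ((Fin m → PadicAlgCl p) ⊗[ℚ_[p]] (Bmax F p)[X]) :=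
  invariantsOn ρv (galBstAlgHom (F := F) (p := p)) U

/-- At `U = ⊤`, `D_{st,⊤}(ρ_v)` is D2-st's `D_st(ρ_v)` (same carrier). [folklore] -/
theorem mem_DstOn_top_iff {m : ℕ} (ρv : FramedRep (absoluteGaloisGroup F) (PadicAlgCl p) m)
    (x : (Fin m → PadicAlgCl p) ⊗[ℚ_[p]] (Bmax F p)[X]) :
    x ∈ DstOn ρv ⊤ ↔ x ∈ Dst ρv :=
  ⟨fun h σ => (mem_invariantsOn_iff _ _ _ x).1 h σ trivial, fun h u => h u⟩

/-- **`φ` on `D_{st,U}(ρ_v)`** (`ℚ̄_p`-linear). [cite: FontaineAsterisque223VIII, Exp. VIII §2.3.7] -/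
def phiDstOn {m : ℕ} (ρv : FramedRep (absoluteGaloisGroup F) (PadicAlgCl p) m)
    (U : Subgroup (absoluteGaloisGroup F)) : DstOn ρv U →ₗ[PadicAlgCl p] DstOn ρv U :=
  phiD (fun u : U => ρv u) (fun u : U => galBstAlgHom (F := F) (p := p) u) (frobBstAlgHom F p)
    fun u => galBstAlgHom_comp_frobBstAlgHom (u : absoluteGaloisGroup F)

/-- **`N` on `D_{st,U}(ρ_v)`** (`ℚ̄_p`-linear). [cite: FontaineAsterisque223VIII, Exp. VIII §2.3.7] -/
def NDstOn {m : ℕ} (ρv : FramedRep (absoluteGaloisGroup F) (PadicAlgCl p) m)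
    (U : Subgroup (absoluteGaloisGroup F)) : DstOn ρv U →ₗ[PadicAlgCl p] DstOn ρv U :=
  endD (fun u : U => ρv u) (fun u : U => galBstAlgHom (F := F) (p := p) u) (NBst F p)
    fun u => galBstAlgHom_comp_NBst (u : absoluteGaloisGroup F)

/-- **`N_D φ_D = p φ_D N_D` on `D_{st,U}(ρ_v)`.** [cite: FontaineAsterisque223VIII, Exp. VIII §2.3.7] -/
theorem NDstOn_phiDstOn {m : ℕ} (ρv : FramedRep (absoluteGaloisGroup F) (PadicAlgCl p) m)
    (U : Subgroup (absoluteGaloisGroup F)) (x : DstOn ρv U) :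
    NDstOn ρv U (phiDstOn ρv U x) = p • phiDstOn ρv U (NDstOn ρv U x) := by
  refine Subtype.ext ?_
  change endTensor (NBst F p) (phiTensor (frobBstAlgHom F p) (x : (Fin m → PadicAlgCl p) ⊗[ℚ_[p]] (Bmax F p)[X])) =
    p • phiTensor (frobBstAlgHom F p) (endTensor (NBst F p) (x : (Fin m → PadicAlgCl p) ⊗[ℚ_[p]] (Bmax F p)[X]))
  induction (x : (Fin m → PadicAlgCl p) ⊗[ℚ_[p]] (Bmax F p)[X]) using TensorProduct.induction_on with
  | zero => simp
  | tmul v b =>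
    simp only [endTensor, phiTensor, TensorProduct.AlgebraTensorModule.map_tmul, LinearMap.id_apply,
      AlgHom.toLinearMap_apply]
    change v ⊗ₜ NBst F p (frobBst F p b) = p • (v ⊗ₜ frobBst F p (NBst F p b))
    rw [NBst_frobBst, map_natCast C, ← nsmul_eq_mul]
    exact map_nsmul (TensorProduct.mk ℚ_[p] (Fin m → PadicAlgCl p) (Bmax F p)[X] v) p _
  | add x y hx hy => simp only [map_add, hx, hy, smul_add]

/-- `N_D φ_D^k = p^k φ_D^k N_D` in `End(D_{st,U})`. [cite: FontaineAsterisque223VIII, Exp. VIII §2.3.7] -/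
theorem NDstOn_mul_phiDstOn_pow {m : ℕ} (ρv : FramedRep (absoluteGaloisGroup F) (PadicAlgCl p) m)
    (U : Subgroup (absoluteGaloisGroup F)) (k : ℕ) :
    NDstOn ρv U * phiDstOn ρv U ^ k = (p ^ k : ℕ) • (phiDstOn ρv U ^ k * NDstOn ρv U) := by
  induction k with
  | zero => simp
  | succ k ih =>
    have h1 : NDstOn ρv U * phiDstOn ρv U = (p : ℕ) • (phiDstOn ρv U * NDstOn ρv U) :=
      LinearMap.ext fun x => by simpa using NDstOn_phiDstOn ρv U x
    rw [pow_succ, ← mul_assoc, ih, smul_mul_assoc, mul_assoc, h1, mul_smul_comm, ← mul_assoc,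
      smul_smul, ← pow_succ]

/-- **The residual action `act_D(g)` of `g ∈ Γ_F` on `D_{st,U}(ρ_v)`** for `U` normal (the descent datum of
`D_pst`: `Γ_F` acts through `Γ_F/U = Gal(L/F)`). [cite: FontaineAsterisque223VIII, Exp. VIII §2.3.7] -/
def actDstOn {m : ℕ} (ρv : FramedRep (absoluteGaloisGroup F) (PadicAlgCl p) m)
    (U : Subgroup (absoluteGaloisGroup F)) [U.Normal] (g : absoluteGaloisGroup F) :
    DstOn ρv U →ₗ[PadicAlgCl p] DstOn ρv U :=
  actOn ρv (galBstAlgHom (F := F) (p := p)) (fun σ τ => map_mul ρv σ τ) galBstAlgHom_mul U g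

/-- `act_D(g) = 1` for `g ∈ U`. [folklore] -/
theorem actDstOn_apply_of_mem {m : ℕ} (ρv : FramedRep (absoluteGaloisGroup F) (PadicAlgCl p) m)
    (U : Subgroup (absoluteGaloisGroup F)) [U.Normal] {g : absoluteGaloisGroup F} (hg : g ∈ U)
    (x : DstOn ρv U) : actDstOn ρv U g x = x :=
  actOn_apply_of_mem _ _ _ _ U hg x

/-- `act_D(g)` commutes with `φ_D`. [folklore] -/
theorem actDstOn_comp_phiDstOn {m : ℕ} (ρv : FramedRep (absoluteGaloisGroup F) (PadicAlgCl p) m)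
    (U : Subgroup (absoluteGaloisGroup F)) [U.Normal] (g : absoluteGaloisGroup F) :
    actDstOn ρv U g ∘ₗ phiDstOn ρv U = phiDstOn ρv U ∘ₗ actDstOn ρv U g :=
  actOn_comp_phiD _ _ _ _ U _ galBstAlgHom_comp_frobBstAlgHom g

/-- `act_D(g)` commutes with `N_D`. [folklore] -/
theorem NDstOn_comp_actDstOn {m : ℕ} (ρv : FramedRep (absoluteGaloisGroup F) (PadicAlgCl p) m)
    (U : Subgroup (absoluteGaloisGroup F)) [U.Normal] (g : absoluteGaloisGroup F) :
    NDstOn ρv U ∘ₗ actDstOn ρv U g = actDstOn ρv U g ∘ₗ NDstOn ρv U :=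
  (actOn_comp_endD _ _ _ _ U _ galBstAlgHom_comp_NBst g).symm

/-- **The Weil–Deligne operator of `w ∈ W_F` on `D_{st,U}(ρ_v)`**: `r_D(w) := act_D(w) ∘ φ_D^{f·(-deg w)}` for
`deg w ≤ 0` (Fontaine's `w̄ ∘ φ^{-α(w)}`, `α(w) = f·deg w`, `f = f(F/ℚ_p)` supplied by the caller; for `deg w > 0`
the exponent truncates to `0`, unused). [cite: FontaineAsterisque223VIII, Exp. VIII §2.3.7] [cite: BuzzardGeeLMS2014, §3.2] -/
def rDstOn {m : ℕ} (ρv : FramedRep (absoluteGaloisGroup F) (PadicAlgCl p) m)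
    (U : Subgroup (absoluteGaloisGroup F)) [U.Normal] (f : ℕ) (w : WeilGroup F) :
    DstOn ρv U →ₗ[PadicAlgCl p] DstOn ρv U :=
  actDstOn ρv U (WeilGroup.toAbsGalois F w) ∘ₗ phiDstOn ρv U ^ (f * (-WeilGroup.deg w).toNat)

/-- **The Weil–Deligne relation** `N_D r_D(w) = p^{f·(-deg w)} r_D(w) N_D` (`= q^{-deg w} r_D(w) N_D`, i.e.
`r_D(w) N_D r_D(w)⁻¹ = q^{deg w} N_D`, the tree's `WeilDeligneRep.conj_N` convention). [cite: FontaineAsterisque223VIII, Exp. VIII §2.3.7]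
[cite: TateCorvallis1979, (4.1.2)] -/
theorem NDstOn_comp_rDstOn {m : ℕ} (ρv : FramedRep (absoluteGaloisGroup F) (PadicAlgCl p) m)
    (U : Subgroup (absoluteGaloisGroup F)) [U.Normal] (f : ℕ) (w : WeilGroup F) :
    NDstOn ρv U ∘ₗ rDstOn ρv U f w =
      (p ^ (f * (-WeilGroup.deg w).toNat) : ℕ) • (rDstOn ρv U f w ∘ₗ NDstOn ρv U) := by
  have h := NDstOn_mul_phiDstOn_pow ρv U (f * (-WeilGroup.deg w).toNat)
  simp only [Module.End.mul_eq_comp] at h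
  rw [rDstOn, ← LinearMap.comp_assoc, NDstOn_comp_actDstOn, LinearMap.comp_assoc, h,
    LinearMap.comp_smul, LinearMap.comp_assoc]

/-- `r_D(w) = 1` for `w ∈ U` of degree `0` (the operator is trivial on the inertia of `L = F̄^U`: smoothness
on inertia). [cite: FontaineAsterisque223VIII, Exp. VIII §2.3.7] -/
theorem rDstOn_eq_one_of_mem {m : ℕ} (ρv : FramedRep (absoluteGaloisGroup F) (PadicAlgCl p) m)
    (U : Subgroup (absoluteGaloisGroup F)) [U.Normal] (f : ℕ) {w : WeilGroup F}
    (hw : WeilGroup.toAbsGalois F w ∈ U) (hdeg : WeilGroup.deg w = 0) :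
    rDstOn ρv U f w = 1 := by
  refine LinearMap.ext fun x => ?_
  simp only [rDstOn, hdeg, neg_zero, Int.toNat_zero, mul_zero, pow_zero, LinearMap.comp_apply,
    Module.End.one_apply]
  exact actDstOn_apply_of_mem ρv U hw x

/-- At `U = ⊤` and `deg w = -1` (a geometric Frobenius): `r_D(w) = φ_D^f` — D2-st's operator
(`SemistableCompatibleAt` compares `φ_D^f`), so the two clauses are normalised identically. [folklore] -/
theorem rDstOn_top_of_deg_eq_neg_one {m : ℕ} (ρv : FramedRep (absoluteGaloisGroup F) (PadicAlgCl p) m)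
    (f : ℕ) {w : WeilGroup F} (hdeg : WeilGroup.deg w = -1) :
    rDstOn ρv ⊤ f w = phiDstOn ρv ⊤ ^ f := by
  refine LinearMap.ext fun x => ?_
  simp only [rDstOn, hdeg, neg_neg, Int.toNat_one, mul_one, LinearMap.comp_apply]
  exact actDstOn_apply_of_mem ρv ⊤ (Subgroup.mem_top _) _

end Bst

/-! ### §3 The potentially semistable Weil–Deligne clause at `v ∣ ℓ` -/

section Clause

variable {n : ℕ} {K : Type} [Field K] [NumberField K] {hcpt : isCompact_glFiniteIntegralLevel n K}
  {ℓ : ℕ} [Fact ℓ.Prime]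

/-- **Potentially semistable Weil–Deligne compatibility at `v ∣ ℓ`** (Buzzard–Gee Conj. 3.2.2, the `p`-adic
Hodge-type clause `WD(ρ|Γ_{K_v})^{F-ss} ≅ rec(π_v)` at EVERY `v ∣ ℓ`, any inertial type, for `GL_n`): for every
local component `π_v` and every `r` over `ℚ̄_ℓ` whose transport `ι(r)` has Frobenius-semisimple class
`rec_v(π_v)`, there are an open normal `U ≤ Γ_{K_v}` (`= Γ_L`) and `f_U ≥ 1` with `deg(W_{K_v} ∩ U) = f_U ℤ`
(`f_U = f(L/K_v)`) such that `D_{st,U}(ρ|Γ_{K_v})` (over the constructed `B_st(K_v)`, canonical instance facts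
of `K_v`) is finite of rank `n·f(v|ℓ)·f_U` over `ℚ̄_ℓ` (`ρ|Γ_{K_v}` becomes SEMISTABLE over `L`) and for every
`w ∈ W_{K_v}` of degree `≤ 0`: `d_{(r_D(w), N_D)}(c, k) = f(v|ℓ)·f_U · d_{(r(w), N_r)}(c, k)` for all `c, k`
(`r_D(w) = act_D(w) ∘ φ_D^{f(v|ℓ)·(-deg w)}`; see the module docstring for why this is the full clause).  No
pinned `p`-adic Hodge datum occurs. [cite: BuzzardGeeLMS2014, Conj. 3.2.2] [cite: FontaineAsterisque223VIII, §2.3.7]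
[cite: TateCorvallis1979, (4.1.3)–(4.2.1)] -/
def PstCompatibleAt (𝓡 : ReciprocityData K) (ι : PadicAlgCl ℓ ≃+* ℂ)
    (π : AutomorphicRepData (AutomorphyDatum.gl n K hcpt)) (ρ : FramedGaloisRep K (PadicAlgCl ℓ) n)
    (v : HeightOneSpectrum (𝓞 K)) (hv : ((ℓ : ℕ) : 𝓞 K) ∈ v.asIdeal) : Prop :=
  haveI := LocalField.charZero_adicCompletion v
  haveI : Fact (¬ IsUnit ((ℓ : ℕ) : integerC (v.adicCompletion K))) :=
    ⟨not_isUnit_natCast_integerC (LocalField.valuation_adicCompletion_natCast_lt_one v ℓ hv)⟩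
  haveI : IsAdicComplete (Ideal.span {((ℓ : ℕ) : integerC (v.adicCompletion K))})
      (integerC (v.adicCompletion K)) :=
    isAdicComplete_integerC_natCast (LocalField.valuation_adicCompletion_natCast_lt_one v ℓ hv)
  ∀ (πv : SmoothIrrep (GL (Fin n) (v.adicCompletion K)))
    (r : WeilDeligneRep (v.adicCompletion K) (PadicAlgCl ℓ) (Fin n → PadicAlgCl ℓ))
    (rℂ : WeilDeligneRep (v.adicCompletion K) ℂ (Fin n → ℂ)),
    π.HasLocalComponentAt v πv.ρ → r.IsTransportAlong (ι : PadicAlgCl ℓ →+* ℂ) rℂ →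
    rℂ.HasFrobSemisimpleClass ((𝓡.llc v).recGL n (IrrClass.mk πv)) →
      ∃ (U : OpenNormalSubgroup (absoluteGaloisGroup (v.adicCompletion K))) (fU : ℕ), 0 < fU ∧
        (∀ w : WeilGroup (v.adicCompletion K),
          WeilGroup.toAbsGalois (v.adicCompletion K) w ∈ (U : Subgroup _) → (fU : ℤ) ∣ WeilGroup.deg w) ∧
        (∃ w : WeilGroup (v.adicCompletion K),
          WeilGroup.toAbsGalois (v.adicCompletion K) w ∈ (U : Subgroup _) ∧ WeilGroup.deg w = fU) ∧
        Module.Finite (PadicAlgCl ℓ) (DstOn (p := ℓ) (ρ.toLocal v) (U : Subgroup _)) ∧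
        Module.finrank (PadicAlgCl ℓ) (DstOn (p := ℓ) (ρ.toLocal v) (U : Subgroup _)) =
          n * v.asIdeal.inertiaDeg ℤ * fU ∧
        ∀ w : WeilGroup (v.adicCompletion K), WeilGroup.deg w ≤ 0 → ∀ (c : PadicAlgCl ℓ) (k : ℕ),
          jordanDatum (V := DstOn (p := ℓ) (ρ.toLocal v) (U : Subgroup _))
              (rDstOn (p := ℓ) (ρ.toLocal v) (U : Subgroup _) (v.asIdeal.inertiaDeg ℤ) w)
              (NDstOn (p := ℓ) (ρ.toLocal v) (U : Subgroup _)) c k =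
            v.asIdeal.inertiaDeg ℤ * fU * jordanDatum (r.ρ w) r.N c k

/-! ### §4 The re-scoped correspondence, (A)/(B), the named conjecture and the ladder -/

/-- **`π` and `ρ` correspond, D2-pst form**: the D2-st clauses (`D2St.CorrespondsD2St`: R3⁺, crystalline
Frobenius–Satake compatibility and the semistable Weil–Deligne clause at every `v ∣ ℓ`) and potentially
semistable Weil–Deligne compatibility at every `v ∣ ℓ`. [cite: BuzzardGeeLMS2014, Conj. 3.2.1 and Conj. 3.2.2] -/
def CorrespondsD2Pst (𝓡 : ReciprocityData K) (ι : PadicAlgCl ℓ ≃+* ℂ)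
    (π : AutomorphicRepData (AutomorphyDatum.gl n K hcpt)) (ρ : FramedGaloisRep K (PadicAlgCl ℓ) n) : Prop :=
  CorrespondsD2St 𝓡 ι π ρ ∧
    ∀ (v : HeightOneSpectrum (𝓞 K)) (hv : ((ℓ : ℕ) : 𝓞 K) ∈ v.asIdeal), PstCompatibleAt 𝓡 ι π ρ v hv

variable (n) in
/-- **(A) Automorphic → Galois, D2-pst form** — the summit's `AutomorphicToGalois` verbatim with
`Corresponds` replaced by `CorrespondsD2Pst`. [cite: BuzzardGeeLMS2014, Conj. 3.2.1 and Conj. 3.2.2] -/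
def AutomorphicToGaloisD2Pst (𝓡 : ReciprocityData K) (hcpt : isCompact_glFiniteIntegralLevel n K) : Prop :=
  ∀ π : CuspidalAutomorphicRepData n K hcpt, π.1.IsLAlgebraic →
    ∀ (ℓ : ℕ) [Fact ℓ.Prime] (ι : PadicAlgCl ℓ ≃+* ℂ),
      ∃ ρ : FramedGaloisRep K (PadicAlgCl ℓ) n,
        ρ.toGaloisRep.IsIrreducible ∧ IsGeometricFramed 𝓡 ρ ∧ CorrespondsD2Pst 𝓡 ι π.1 ρ ∧
          ∀ ρ' : FramedGaloisRep K (PadicAlgCl ℓ) n, CorrespondsD2Pst 𝓡 ι π.1 ρ' → IsConjugate ρ ρ'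

variable (n) in
/-- **(B) Galois → automorphic, D2-pst form** — the summit's `GaloisToAutomorphic` verbatim with
`Corresponds` replaced by `CorrespondsD2Pst`. [cite: FontaineMazurGeometric1995, Conj. 1]
[cite: BuzzardGeeLMS2014, Conj. 3.2.2] -/
def GaloisToAutomorphicD2Pst (𝓡 : ReciprocityData K) (hcpt : isCompact_glFiniteIntegralLevel n K) : Prop :=
  ∀ (ℓ : ℕ) [Fact ℓ.Prime] (ι : PadicAlgCl ℓ ≃+* ℂ) (ρ : FramedGaloisRep K (PadicAlgCl ℓ) n),
    ρ.toGaloisRep.IsIrreducible → IsGeometricFramed 𝓡 ρ →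
      ∃ π : CuspidalAutomorphicRepData n K hcpt, π.1.IsLAlgebraic ∧ CorrespondsD2Pst 𝓡 ι π.1 ρ

variable (n K) in
/-- **Global Langlands reciprocity for `GL_n` over `K`, D2-pst form**: (A) ∧ (B).
[cite: BuzzardGeeLMS2014, Conj. 3.2.2] [cite: FontaineMazurGeometric1995, Conj. 1] -/
def GlobalLanglandsCorrespondenceGLnD2Pst (𝓡 : ReciprocityData K)
    (hcpt : isCompact_glFiniteIntegralLevel n K) : Prop :=
  AutomorphicToGaloisD2Pst n 𝓡 hcpt ∧ GaloisToAutomorphicD2Pst n 𝓡 hcpt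

end Clause

end D2Pst

/-- **`LanglandsD2Pst`** — the summit `Langlands` with its `v ∣ ℓ` clause re-scoped to R3⁺ PLUS, at every
`v ∣ ℓ`, the FULL `p`-adic Hodge-type clause of Buzzard–Gee 3.2.2 over the constructed `B_st(K_v)`: D2-cris,
D2-st, and the potentially semistable clause with its descent datum (this file), NO pinned datum; same outer
quantifier shape as `Langlands`.  OPEN named conjecture stated in our theories (`@[conjecture]` obligation
node; not a Literature fact, not the operator's Statement — the Theorems-side shadow of the statement-level
content of repair D2-min). [cite: BuzzardGeeLMS2014, Conj. 3.2.1 and Conj. 3.2.2] [cite: FontaineMazurGeometric1995, Conj. 1] -/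
@[conjecture] def LanglandsD2Pst : Prop :=
  ∀ (F : Type) [Field F] [NumberField F],
    Nonempty (Summit.Langlands.ReciprocityData F) ∧
      ∀ (𝓡 : Summit.Langlands.ReciprocityData F) (n : ℕ), 0 < n →
        ∀ hcpt : isCompact_glFiniteIntegralLevel n F,
          D2Pst.GlobalLanglandsCorrespondenceGLnD2Pst n F 𝓡 hcpt

/-- **The repair ladder: `LanglandsD2Pst → LanglandsD2St`** (given Deligne–Serre uniqueness for the
uniqueness clause of (A), exactly as for `langlandsD2Cris_of_langlandsD2St`). [cite: DeligneSerreASENS1974, Lemme 3.2 (p. 513)] -/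
theorem langlandsD2St_of_langlandsD2Pst
    (hDS : ∀ (K : Type) [Field K] [NumberField K] (ℓ n : ℕ) [Fact ℓ.Prime],
      D2Cris.DeligneSerreUniqueness K ℓ n)
    (h : LanglandsD2Pst) : LanglandsD2St := by
  intro F _ _
  obtain ⟨hne, hall⟩ := h F
  refine ⟨hne, fun 𝓡 n hn hcpt => ?_⟩
  obtain ⟨hA, hB⟩ := hall 𝓡 n hn hcpt
  refine ⟨fun π hπ ℓ _ ι => ?_, fun ℓ _ ι ρ hirr hgeo => ?_⟩
  · obtain ⟨ρ, hirr, hgeo, hcor, _⟩ := hA π hπ ℓ ι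
    exact ⟨ρ, hirr, hgeo, hcor.1, fun ρ' h' =>
      hDS F ℓ n ρ ρ' hirr (R3plus.eventually_frobCharpoly_of_correspondsR3plus hcor.1.1.1 h'.1.1)⟩
  · obtain ⟨π, hπ, hcor⟩ := hB ℓ ι ρ hirr hgeo
    exact ⟨π, hπ, hcor.1⟩

/-- **`LanglandsD2Pst → LanglandsR3plus`** (composition of the rungs). [cite: DeligneSerreASENS1974, Lemme 3.2 (p. 513)] -/
theorem langlandsR3plus_of_langlandsD2Pst
    (hDS : ∀ (K : Type) [Field K] [NumberField K] (ℓ n : ℕ) [Fact ℓ.Prime],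
      D2Cris.DeligneSerreUniqueness K ℓ n)
    (h : LanglandsD2Pst) : LanglandsR3plus :=
  langlandsR3plus_of_langlandsD2St hDS (langlandsD2St_of_langlandsD2Pst hDS h)

end Summit.Langlands.Langlands.Theorems

end
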